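import Literature.NumberTheory.IwasawaTheory.ClassicalMuVanishesBoundedRankAlgebra
import Literature.NumberTheory.IwasawaTheory.Fukuda1994Thm1RankPackage
import Literature.NumberTheory.IwasawaTheory.FukudaGroupLayers
import Literature.NumberTheory.IwasawaTheory.ZpExtensionTotallyRamifiedFrom
import HarnessLib

/-!
# Growth-form `μ = 0` ⟹ the `p`-ranks of the class groups along a `ℤ_p`-extension are BOUNDED (proved at finite level,
# WITHOUT Iwasawa's structure theory of `Λ`-modules)

Topic `NumberTheory/IwasawaTheory` (namespace = path). THEOREM-ONLY file (no definition, no named fact, no `sorry`), written by the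
prover seat `bsd-potss-k8t-c4` g22 (cell `bsd-potss`; μ-road of stmt-BirchSwinnertonDyer-19982; closes nothing).

THE THEOREM (`exists_forall_classGroupPRank_le_of_classicalMuVanishes`). `K` a number field, `p` a prime, `κ` a `ℤ_p`-extension of `K`
with layers `K_n`: if `e_n = ord_p h(K_n)` grows as `λ n + ν` for `n ≫ 0` (`ClassicalMuVanishes κ`, the tree's growth form of Iwasawa's
`μ = 0`), then `rank_p Cl(K_n)` (`classGroupPRank κ n`) is bounded in `n`.  This is the half «`μ = 0` ⟹ `rank A_n` bounded» of
Washington's Prop. 13.23 / Lang's Thm. 1.2 («`μ = 0` iff `X` is finitely generated over `ℤ_p` iff the `p`-ranks are bounded»), which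
in print rests on the structure theory of finitely generated `Λ`-modules (the tree's named fact `iwasawa1959_classNumberPExp_growth`);
here it is proved at FINITE LEVEL, in the finite Galois group `Gal(H_p(K_{n+t})/K_n)` packaged by `Fukuda1994Thm1RankPackage.exists_layer_package`
(g20): with `A = Gal(H_p/K_{n+t})`, `φ` = conjugation by a totally ramified inertia generator, `Y₀ = G'·⟨inertia⟩ ∩ A`, `ν_j = ∑_{i<p^j} φ^i`,
`pA`, one has `p^{r_{n+j}} = #(A/(ν_jY₀ + pA))` for `j ≤ t` (Washington Lemma 13.18, tree `FukudaGroup.relIndex_commutator_sup_layer_pow_mul_card`)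
and `ν_tY₀ = 0`.  Since `ν_j ≡ (φ − 1)^{p^j − 1} (mod p)` (`MuZeroRank.geom_sum_apply_mem`), `r_{n+j} ≥ dim Ā/T̄^{p^j−1}Ā` and
`dim Ā/T̄Ā ≤ r_{n+1}` for `Ā = A/pA`, `T̄ = φ − 1` (nilpotent on `Ā`: `φ^{p^t} = 1`); the nilpotent-filtration count
(`MuZeroRank.card_quotient_smul_le_pow`) then gives the

WINDOW LEMMA (`classGroupPRank_add_le_mul_of_lt`): for `n ≥ n₀` (Fukuda's index, `TotallyRamifiedFrom κ n₀`) and `1 ≤ j ≤ t`,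
`r_{n+j} + 1 < p^j ⟹ r_{n+t} ≤ (p^j − 2)·r_{n+1}`.

With linear `e` one picks `j` with `e_{n+j} + 1 < p^j` (exponential beats linear), uses `r_m ≤ e_m` (`classGroupPRank_le_classNumberPExp`),
and bounds the finitely many earlier ranks trivially.

Consequences (sibling files): Coates–Sujatha 2005 Thm. 3.4 VERBATIM (`CoatesSujatha2005.thm34_…_holds`, via the bounded-rank form
`fineSelmerDual_moduleFinite_of_classGroupPRank_le` of g21) and the character form of `μ = 0` (`classicalMuVanishes_finite_unramifiedClasses`).

References: [Washington1997] L. Washington, *Introduction to Cyclotomic Fields*, 2nd ed., §13.3 Lemmas 13.14–13.18, Prop. 13.22, Prop. 13.23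
(«`μ = 0` ⟺ `rank A_n` bounded») and its proof; [Lang1990] S. Lang, *Cyclotomic Fields I and II*, Ch. 5 §1 Thm. 1.2; [Fukuda1994] T. Fukuda,
Proc. Japan Acad. 70 A (1994), p. 264 (the index `n₀`).
-/

noncomputable section

open scoped NumberField IsMulCommutative
open NumberField Field Finset

namespace Literature.NumberTheory.IwasawaTheory

open Literature.NumberTheory.EllipticCurves

/-! ## §1 Reading the package: `p^{r_{n+j}} = #(A/(ν_j Y₀ + pA))` -/

section Package

variable {G : Type*} [Group G] {A : Subgroup G} [A.Normal] [IsMulCommutative A] [Finite G] {p : ℕ} [hp : Fact p.Prime]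
  {g : G} {𝓘 : Set (Subgroup G)} {t : ℕ}

/-- In the setting of `FukudaGroupLayers`: `[G_j : N_jP_j] = #(A/(ν_jY₀ + pA))` for the subgroup `G_j ⊇ A` of index `p^j` (`j ≤ t`).
[cite: Washington1997, §13.3 Lemma 13.18] -/
private theorem relIndex_layer_pow_eq_card_quotient (hgA : Subgroup.zpowers g ⊓ A = ⊥) (hgen : A ⊔ Subgroup.zpowers g = ⊤)
    (hind : A.index = p ^ t) (h𝓘 : ∀ I ∈ 𝓘, I ⊓ A = ⊥ ∧ (I = ⊥ ∨ I ⊔ A = ⊤)) (hg𝓘 : Subgroup.zpowers g ∈ 𝓘)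
    {j : ℕ} (hj : j ≤ t) {Gj : Subgroup G} (hAGj : A ≤ Gj) (hGj : Gj.index = p ^ j) :
    ((⁅Gj, Gj⁆ ⊔ ⨆ I ∈ 𝓘, I ⊓ Gj) ⊔ Subgroup.closure ((fun x : G => x ^ p) '' (Gj : Set G))).relIndex Gj =
      Nat.card (Additive A ⧸ ((FukudaGroup.subOf A (⁅(⊤ : Subgroup G), ⊤⁆ ⊔ ⨆ I ∈ 𝓘, I)).map
          (∑ i ∈ range (p ^ j), FukudaGroup.conjEnd A g ^ i) ⊔
        (⊤ : Submodule ℤ (Additive A)).map ((p : ℤ) • (1 : Module.End ℤ (Additive A))))) := by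
  have h := FukudaGroup.relIndex_commutator_sup_layer_pow_mul_card hgA hgen hind h𝓘 hg𝓘 hj hAGj hGj
  set S : Submodule ℤ (Additive A) := (FukudaGroup.subOf A (⁅(⊤ : Subgroup G), ⊤⁆ ⊔ ⨆ I ∈ 𝓘, I)).map
      (∑ i ∈ range (p ^ j), FukudaGroup.conjEnd A g ^ i) ⊔
    (⊤ : Submodule ℤ (Additive A)).map ((p : ℤ) • (1 : Module.End ℤ (Additive A))) with hS
  have hcardA : Nat.card A = Nat.card S * Nat.card (Additive A ⧸ S) := Submodule.card_eq_card_quotient_mul_card S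
  rw [hcardA] at h
  rw [mul_comm] at h
  exact Nat.eq_of_mul_eq_mul_left Nat.card_pos h

end Package

variable {K : Type} [Field K] [NumberField K] {p : ℕ} [hp : Fact p.Prime]

/-! ## §2 The window lemma -/

/-- **WINDOW LEMMA.** For a `ℤ_p`-extension `κ` with Fukuda index `n₀ ≤ n` and `1 ≤ j ≤ t`: if `rank_p Cl(K_{n+j}) + 1 < p^j` then
`rank_p Cl(K_{n+t}) ≤ (p^j − 2) · rank_p Cl(K_{n+1})`.  (At top `K_{n+t}`: `r_{n+j} ≥ dim Ā/T̄^{p^j−1}Ā`, `dim Ā/T̄Ā ≤ r_{n+1}`, `dim Ā = r_{n+t}`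
for `Ā = A/pA`, `T̄ = φ − 1` nilpotent; then the nilpotent-filtration count.) The finite shadow of «`X/pX` infinite ⟹ `rank A_n ≥ p^n − 1 − c`»
in the proof of «`μ = 0` iff `rank A_n` bounded». [cite: Washington1997, §13.3 Prop. 13.23 (proof), Lemma 13.18] [cite: Lang1990, Ch. 5 §1 Thm. 1.2] -/
theorem classGroupPRank_add_le_mul_of_lt (κ : ZpExtension K p) {n₀ n : ℕ} (hκ : TotallyRamifiedFrom κ n₀) (hn : n₀ ≤ n)
    {j t : ℕ} (hj : 1 ≤ j) (hjt : j ≤ t) (hlt : classGroupPRank κ (n + j) + 1 < p ^ j) :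
    classGroupPRank κ (n + t) ≤ (p ^ j - 2) * classGroupPRank κ (n + 1) := by
  classical
  have hp1 : 1 < p := hp.out.one_lt
  obtain ⟨G, _instG, _instF, A', hA'n, _instC, g, 𝓘, hgA, hgen, hA'index, h𝓘, hg𝓘, -, hlayer⟩ :=
    exists_layer_package κ hκ hn t (hj.trans hjt)
  -- notation: `φ` = conjugation by `g`, `Y₀ = N₀ ∩ A`, `P = pA`
  obtain ⟨φ, hφ⟩ : ∃ φ : Module.End ℤ (Additive A'), φ = FukudaGroup.conjEnd A' g := ⟨_, rfl⟩
  obtain ⟨Y₀, hY₀⟩ : ∃ Y₀ : Submodule ℤ (Additive A'), Y₀ = FukudaGroup.subOf A' (⁅(⊤ : Subgroup G), ⊤⁆ ⊔ ⨆ I ∈ 𝓘, I) :=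
    ⟨_, rfl⟩
  have hP : (⊤ : Submodule ℤ (Additive A')).map ((p : ℤ) • (1 : Module.End ℤ (Additive A'))) =
      LinearMap.range ((p : ℤ) • (1 : Module.End ℤ (Additive A'))) := Submodule.map_top _
  -- the ranks as cardinalities: `p^{r_{n+i}} = #(A/(ν_iY₀ + pA))`
  have hr : ∀ i, i ≤ t → p ^ classGroupPRank κ (n + i) =
      Nat.card (Additive A' ⧸ (Y₀.map (∑ l ∈ range (p ^ i), φ ^ l) ⊔
        LinearMap.range ((p : ℤ) • (1 : Module.End ℤ (Additive A'))))) := by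
    intro i hi
    obtain ⟨Gi, hAGi, hGi, -, hri⟩ := hlayer i hi
    rw [← hri, hY₀, hφ, ← hP]
    exact relIndex_layer_pow_eq_card_quotient hgA hgen hA'index h𝓘 hg𝓘 hi hAGi hGi
  -- (C1) `ν_iY₀ + pA ⊆ (φ − 1)^{p^i − 1}A + pA`
  have hincl : ∀ i, Y₀.map (∑ l ∈ range (p ^ i), φ ^ l) ⊔ LinearMap.range ((p : ℤ) • (1 : Module.End ℤ (Additive A'))) ≤
      LinearMap.range ((φ - 1) ^ (p ^ i - 1)) ⊔ LinearMap.range ((p : ℤ) • (1 : Module.End ℤ (Additive A'))) := by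
    intro i
    refine sup_le ?_ le_sup_right
    rintro _ ⟨y, -, rfl⟩
    exact MuZeroRank.geom_sum_apply_mem p i φ y
  -- nilpotency of `φ − 1` modulo `p`: `φ^{p^t} = 1`
  have hnil : ∃ N : ℕ, LinearMap.range ((φ - 1) ^ N) ≤ LinearMap.range ((p : ℤ) • (1 : Module.End ℤ (Additive A'))) := by
    refine ⟨p ^ t, ?_⟩
    rintro _ ⟨v, rfl⟩
    have hφt : φ ^ (p ^ t) = 1 := by rw [hφ]; exact FukudaGroup.conjEnd_pow_index_eq_one hgA hgen hA'index
    exact MuZeroRank.pow_prime_pow_apply_mem_of_pow_eq_one p t φ hφt v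
  -- top layer: `#(A/pA) = p^{r_{n+t}}` (`ν_tY₀ = 0`)
  have htop : Nat.card (Additive A' ⧸ LinearMap.range ((p : ℤ) • (1 : Module.End ℤ (Additive A')))) =
      p ^ classGroupPRank κ (n + t) := by
    rw [hr t le_rfl, hY₀, hφ, FukudaGroup.map_subOf_commutator_sup_index_eq_bot hgA hgen hA'index h𝓘 hg𝓘, bot_sup_eq]
  -- `k = p^j − 1 ≥ 1`
  have hpj : 2 ≤ p ^ j := le_trans hp.out.two_le (Nat.le_self_pow (by omega) p)
  set k : ℕ := p ^ j - 1 with hk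
  have hk1 : 1 ≤ k := by omega
  -- hypothesis of the count: `#(A/((φ−1)^kA + pA)) ≤ p^{r_{n+j}} < p^k`
  have hWk : Nat.card (Additive A' ⧸ (LinearMap.range ((φ - 1) ^ k) ⊔
      LinearMap.range ((p : ℤ) • (1 : Module.End ℤ (Additive A'))))) < p ^ k :=
    calc _ ≤ Nat.card (Additive A' ⧸ (Y₀.map (∑ l ∈ range (p ^ j), φ ^ l) ⊔
          LinearMap.range ((p : ℤ) • (1 : Module.End ℤ (Additive A'))))) := MuZeroRank.card_quotient_le_of_le (hincl j)
      _ = p ^ classGroupPRank κ (n + j) := (hr j hjt).symm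
      _ < p ^ k := Nat.pow_lt_pow_right hp1 (by omega)
  have hcount := MuZeroRank.card_quotient_smul_le_pow (φ - 1) hnil hk1 hWk
  -- `#(A/((φ−1)A + pA)) ≤ p^{r_{n+1}}` (`ν_1Y₀ + pA ⊆ (φ−1)^{p−1}A + pA ⊆ (φ−1)A + pA`)
  have hW1 : Nat.card (Additive A' ⧸ (LinearMap.range (φ - 1) ⊔ LinearMap.range ((p : ℤ) • (1 : Module.End ℤ (Additive A'))))) ≤
      p ^ classGroupPRank κ (n + 1) := by
    rw [hr 1 (hj.trans hjt)]
    refine MuZeroRank.card_quotient_le_of_le ((hincl 1).trans (sup_le_sup_right ?_ _))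
    have h1 : p ^ 1 - 1 = (p - 2) + 1 := by have := hp.out.two_le; rw [pow_one]; omega
    rw [h1, pow_succ', Module.End.mul_eq_comp]
    exact LinearMap.range_comp_le_range _ _
  -- combine: `p^{r_{n+t}} ≤ (p^{r_{n+1}})^{k−1}`
  rw [htop] at hcount
  have h2 : p ^ classGroupPRank κ (n + t) ≤ p ^ ((k - 1) * classGroupPRank κ (n + 1)) :=
    calc _ ≤ _ := hcount
      _ ≤ (p ^ classGroupPRank κ (n + 1)) ^ (k - 1) := Nat.pow_le_pow_left hW1 _
      _ = p ^ ((k - 1) * classGroupPRank κ (n + 1)) := by rw [← pow_mul, mul_comm]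
  have h3 := (Nat.pow_le_pow_iff_right hp1).mp h2
  have hk2 : k - 1 = p ^ j - 2 := by omega
  rwa [hk2] at h3

/-! ## §3 The theorem -/

/-- **`rank_p Cl(K_m) ≤ ord_p h(K_m)`**: `#(Cl/Clᵖ)` divides `#Cl`. [cite: Washington1997, §13.3 (proof of Prop. 13.23: `e_n ≥ rank A_n`)] -/
theorem classGroupPRank_le_classNumberPExp (κ : ZpExtension K p) (m : ℕ) : classGroupPRank κ m ≤ classNumberPExp κ m := by
  haveI : FiniteDimensional K (κ.layer m) := κ.finiteDimensional_layer_holds m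
  haveI : NumberField (κ.layer m) := NumberField.of_module_finite K _
  rw [classGroupPRank_def, classNumberPExp_def]
  have hdvd := Subgroup.card_quotient_dvd_card
    ((powMonoidHom p : ClassGroup (𝓞 (κ.layer m)) →* ClassGroup (𝓞 (κ.layer m))).range)
  have hne : Nat.card (ClassGroup (𝓞 (κ.layer m))) ≠ 0 := Nat.card_pos.ne'
  exact (padicValNat_dvd_iff_le hne).mp (dvd_trans pow_padicValNat_dvd hdvd)

/-- **GROWTH-FORM `μ = 0` ⟹ BOUNDED `p`-RANKS.** For a `ℤ_p`-extension `κ` of a number field `K`: if `ord_p h(K_n) = λ n + ν` for all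
`n ≥ n₀` (`ClassicalMuVanishes κ`), then `rank_p Cl(K_n) ≤ B` for all `n`, for some `B`.  Proof at finite level: Fukuda's index
(`exists_totallyRamifiedFrom`), a window `[n, n + j]` with `e_{n+j} + 1 < p^j` (exponential beats linear, `MuZeroRank.exists_mul_add_lt_two_pow`),
`r ≤ e` (`classGroupPRank_le_classNumberPExp`), and the window lemma for every `t ≥ j`.  In print this is the direction
«`μ = 0` ⟹ `X` finitely generated over `ℤ_p` ⟹ `rank A_n` bounded» of Washington's Prop. 13.23 / Lang's Thm. 1.2, via the structure
theory of `Λ`-modules; no structure theory is used here. [cite: Washington1997, §13.3 Prop. 13.23] [cite: Lang1990, Ch. 5 §1 Thm. 1.2 (iii)] -/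
theorem exists_forall_classGroupPRank_le_of_classicalMuVanishes (κ : ZpExtension K p) (hμ : ClassicalMuVanishes κ) :
    ∃ B : ℕ, ∀ m, classGroupPRank κ m ≤ B := by
  classical
  obtain ⟨n₀, hn₀⟩ := exists_totallyRamifiedFrom κ
  obtain ⟨l, ν, n₁, hl⟩ := hμ
  obtain ⟨n, hn⟩ : ∃ n : ℕ, n = max n₀ n₁ := ⟨_, rfl⟩
  have hn0 : n₀ ≤ n := hn ▸ le_max_left _ _
  have hn1 : n₁ ≤ n := hn ▸ le_max_right _ _
  -- a window `[n, n + j]` with `e_{n+j} + 1 < p^j`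
  obtain ⟨j, hj1, hj⟩ := MuZeroRank.exists_mul_add_lt_two_pow l (l * n + ν.toNat + 1)
  have hpj : 2 ^ j ≤ p ^ j := Nat.pow_le_pow_left hp.out.two_le j
  have hlt : classGroupPRank κ (n + j) + 1 < p ^ j := by
    have h1 := classGroupPRank_le_classNumberPExp κ (n + j)
    have h2 := hl (n + j) (hn1.trans (Nat.le_add_right _ _))
    have hν : ν ≤ (ν.toNat : ℤ) := Int.self_le_toNat ν
    have h3 : ((l * j + (l * n + ν.toNat + 1) : ℕ) : ℤ) < ((2 ^ j : ℕ) : ℤ) := by exact_mod_cast hj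
    have h4 : ((2 ^ j : ℕ) : ℤ) ≤ ((p ^ j : ℕ) : ℤ) := by exact_mod_cast hpj
    have h5 : (classGroupPRank κ (n + j) : ℤ) ≤ classNumberPExp κ (n + j) := by exact_mod_cast h1
    have h6 : ((classGroupPRank κ (n + j) + 1 : ℕ) : ℤ) < ((p ^ j : ℕ) : ℤ) := by
      push_cast at h2 h3 h4 ⊢
      nlinarith
    exact_mod_cast h6
  -- the bound
  refine ⟨max ((p ^ j - 2) * classGroupPRank κ (n + 1)) ((Finset.range (n + j)).sup (classGroupPRank κ)), fun m => ?_⟩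
  by_cases hm : n + j ≤ m
  · obtain ⟨t, rfl⟩ : ∃ t, m = n + t := ⟨m - n, by omega⟩
    exact (classGroupPRank_add_le_mul_of_lt κ hn₀ hn0 hj1 (by omega) hlt).trans (le_max_left _ _)
  · exact (Finset.le_sup (f := classGroupPRank κ) (Finset.mem_range.mpr (by omega))).trans (le_max_right _ _)

/-- The same, for a `ℤ_p`-extension whose `p`-class numbers are eventually CONSTANT (`λ = 0`). [cite: Washington1997, §13.3 Prop. 13.23]
[cite: Lang1990, Ch. 5 §4 Thm. 4.3] -/
theorem exists_forall_classGroupPRank_le_of_eventually_const (κ : ZpExtension K p) {c n₀ : ℕ}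
    (h : ∀ n, n₀ ≤ n → classNumberPExp κ n = c) : ∃ B : ℕ, ∀ m, classGroupPRank κ m ≤ B :=
  exists_forall_classGroupPRank_le_of_classicalMuVanishes κ (classicalMuVanishes_of_eventually_const κ h)


/-! ## §4 APPEND (same seat, g22): LINEAR UPPER BOUNDS on `e_n` — the currency of the μ-descent roads — already bound the `p`-ranks

The proof of `exists_forall_classGroupPRank_le_of_classicalMuVanishes` uses the growth form only through the upper bound
`e_{n+j} ≤ λ(n+j) + ν`.  The μ-descent roads of the cell (norm relations, Kuroda, `p`-prime index: `ClassicalMuVanishesDescent`,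
`ClassicalMuVanishesSubextension`, `ClassicalMuVanishesKleinDescent`, …) deliver exactly such LINEAR UPPER BOUNDS
`e_n(L) ≤ ∑ cᵢ e_n(Kᵢ) + b ≤ a n + b'` for the big field from `μ = 0` of small subfields, and so far paid Iwasawa's growth theorem (`hI`,
`classicalMuVanishes_of_classNumberPExp_le_linear`) to turn the bound back into the growth form; for statement (A) (bounded ranks suffice,
Coates–Sujatha Thm. 3.4 in the form of `FineSelmerClassGroupPRankBoundedProofs`) that detour is unnecessary.  The linear bound is written
inline as `∃ a b n₁ : ℕ, ∀ n, n₁ ≤ n → classNumberPExp κ n ≤ a * n + b` (no new definition). -/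

omit [NumberField K] in
/-- Growth form ⟹ linear upper bound (`ν ≤ |ν|`). [cite: Lang1990, Ch. 5 §1 Thm. 1.2 (iii)] -/
theorem exists_classNumberPExp_le_linear_of_classicalMuVanishes (κ : ZpExtension K p) (hμ : ClassicalMuVanishes κ) :
    ∃ a b n₁ : ℕ, ∀ n, n₁ ≤ n → classNumberPExp κ n ≤ a * n + b := by
  obtain ⟨l, ν, n₁, hl⟩ := hμ
  refine ⟨l, ν.natAbs, n₁, fun n hn => ?_⟩
  have h1 := hl n hn
  have h2 : (classNumberPExp κ n : ℤ) ≤ l * n + (ν.natAbs : ℤ) := by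
    rw [h1]; have := @Int.le_natAbs ν; linarith
  exact_mod_cast h2

omit [NumberField K] in
/-- **μ-descent in LINEAR-BOUND currency (chaining form; no growth theorem).** If `e_n(κ) ≤ ∑ᵢ cᵢ·e_n(κᵢ) + b` for `n ≥ n₀` (finitely
many `ℤ_p`-extensions `κᵢ` of other fields — the per-layer norm-relation / Kuroda / `p`-prime-index inequalities) and every `e_n(κᵢ)`
is linearly bounded, then `e_n(κ)` is linearly bounded. (The arithmetic inside `ClassicalMuVanishesDescent.classicalMuVanishes_of_le_sum`,
without its final appeal to `iwasawa1959_classNumberPExp_growth`.) [cite: BiasseEtAl2022, Prop. 3.7] [cite: Lang1990, Ch. 5 §1 Thm. 1.2 (iii)] -/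
theorem exists_classNumberPExp_le_linear_of_le_sum (κ : ZpExtension K p)
    {ι : Type} [Fintype ι] {F : ι → Type} [∀ i, Field (F i)]
    (κs : ∀ i, ZpExtension (F i) p) (c : ι → ℕ) {b n₀ : ℕ}
    (hle : ∀ n, n₀ ≤ n → classNumberPExp κ n ≤ (∑ i, c i * classNumberPExp (κs i) n) + b)
    (hbd : ∀ i, ∃ a b n₁ : ℕ, ∀ n, n₁ ≤ n → classNumberPExp (κs i) n ≤ a * n + b) :
    ∃ a b n₁ : ℕ, ∀ n, n₁ ≤ n → classNumberPExp κ n ≤ a * n + b := by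
  classical
  choose l ν m hm using hbd
  set N := n₀ + ∑ i, m i with hN
  have hmi : ∀ i, m i ≤ N := fun i =>
    (Finset.single_le_sum (fun j _ => Nat.zero_le (m j)) (Finset.mem_univ i)).trans (Nat.le_add_left _ _)
  refine ⟨∑ i, c i * l i, (∑ i, c i * ν i) + b, N, fun n hn => ?_⟩
  have h0 : n₀ ≤ n := le_trans (Nat.le_add_right _ _) hn
  calc classNumberPExp κ n ≤ (∑ i, c i * classNumberPExp (κs i) n) + b := hle n h0
    _ ≤ (∑ i, c i * (l i * n + ν i)) + b := by
        gcongr with i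
        exact hm i n ((hmi i).trans hn)
    _ = (∑ i, c i * l i) * n + ((∑ i, c i * ν i) + b) := by
        rw [Finset.sum_mul, ← add_assoc, ← Finset.sum_add_distrib]
        refine congrArg (· + b) (Finset.sum_congr rfl fun i _ => by ring)

omit [NumberField K] in
/-- One-term form of the chaining: `e_n(κ) ≤ c·e_n(κ') + b` eventually and `e_n(κ')` linearly bounded ⟹ `e_n(κ)` linearly bounded
(e.g. `p`-prime index, `ClassicalMuVanishesSubextension.classNumberPExp_restrict_le_of_not_dvd_finrank`, `c = 1`, `b = 0`).
[cite: Lang1990, Ch. 5 §1 Thm. 1.2 (iii)] [cite: NeukirchANT1999, Ch. III §1 Prop. (1.6) (ii)] -/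
theorem exists_classNumberPExp_le_linear_of_le {K' : Type} [Field K'] (κ : ZpExtension K p) (κ' : ZpExtension K' p) {c b n₀ : ℕ}
    (hle : ∀ n, n₀ ≤ n → classNumberPExp κ n ≤ c * classNumberPExp κ' n + b)
    (hbd : ∃ a b n₁ : ℕ, ∀ n, n₁ ≤ n → classNumberPExp κ' n ≤ a * n + b) :
    ∃ a b n₁ : ℕ, ∀ n, n₁ ≤ n → classNumberPExp κ n ≤ a * n + b :=
  exists_classNumberPExp_le_linear_of_le_sum κ (ι := Unit) (fun _ => κ') (fun _ => c) (b := b) (n₀ := n₀)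
    (fun n hn => by simpa using hle n hn) (fun _ => hbd)

/-- **LINEAR UPPER BOUND ⟹ BOUNDED `p`-RANKS.** For a `ℤ_p`-extension `κ` of a number field: if `ord_p h(K_n) ≤ a·n + b` for all
`n ≥ n₁`, then `rank_p Cl(K_n)` is bounded (same finite-level proof as `exists_forall_classGroupPRank_le_of_classicalMuVanishes`: a window
`[n, n+j]` with `a(n+j) + b + 1 < p^j`, `r ≤ e`, the window lemma). In print a linear upper bound forces `μ = 0` by Iwasawa's growth theorem,
whence bounded ranks by the structure theory; neither is used here. [cite: Washington1997, §13.3 Prop. 13.23] [cite: Lang1990, Ch. 5 §1 Thm. 1.2 (iii)] -/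
theorem exists_forall_classGroupPRank_le_of_classNumberPExp_le_linear (κ : ZpExtension K p) {a b n₁ : ℕ}
    (hle : ∀ n, n₁ ≤ n → classNumberPExp κ n ≤ a * n + b) : ∃ B : ℕ, ∀ m, classGroupPRank κ m ≤ B := by
  classical
  obtain ⟨n₀, hn₀⟩ := exists_totallyRamifiedFrom κ
  obtain ⟨n, hn⟩ : ∃ n : ℕ, n = max n₀ n₁ := ⟨_, rfl⟩
  have hn0 : n₀ ≤ n := hn ▸ le_max_left _ _
  have hn1 : n₁ ≤ n := hn ▸ le_max_right _ _
  -- a window `[n, n + j]` with `a(n+j) + b + 1 < p^j`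
  obtain ⟨j, hj1, hj⟩ := MuZeroRank.exists_mul_add_lt_two_pow a (a * n + b + 1)
  have hpj : 2 ^ j ≤ p ^ j := Nat.pow_le_pow_left hp.out.two_le j
  have hlt : classGroupPRank κ (n + j) + 1 < p ^ j := by
    have h1 := classGroupPRank_le_classNumberPExp κ (n + j)
    have h2 := hle (n + j) (hn1.trans (Nat.le_add_right _ _))
    rw [Nat.mul_add] at h2
    omega
  refine ⟨max ((p ^ j - 2) * classGroupPRank κ (n + 1)) ((Finset.range (n + j)).sup (classGroupPRank κ)), fun m => ?_⟩
  by_cases hm : n + j ≤ m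
  · obtain ⟨t, rfl⟩ : ∃ t, m = n + t := ⟨m - n, by omega⟩
    exact (classGroupPRank_add_le_mul_of_lt κ hn₀ hn0 hj1 (by omega) hlt).trans (le_max_left _ _)
  · exact (Finset.le_sup (f := classGroupPRank κ) (Finset.mem_range.mpr (by omega))).trans (le_max_right _ _)

/-- **μ-DESCENT STRAIGHT TO BOUNDED RANKS (no growth theorem).** Same hypotheses as `ClassicalMuVanishesDescent.classicalMuVanishes_of_le_sum`
MINUS `hI`: if `e_n(κ) ≤ ∑ᵢ cᵢ·e_n(κᵢ) + b` for `n ≥ n₀` and every `κᵢ` (a `ℤ_p`-extension of a number field) has `μ = 0` in growth form,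
then the `p`-ranks `rank_p Cl(K_n)` of `κ` are BOUNDED — the input of Coates–Sujatha Thm. 3.4 in bounded-rank form.
[cite: BiasseEtAl2022, Prop. 3.7] [cite: Washington1997, §13.3 Prop. 13.23] -/
theorem exists_forall_classGroupPRank_le_of_le_sum (κ : ZpExtension K p)
    {ι : Type} [Fintype ι] {F : ι → Type} [∀ i, Field (F i)]
    (κs : ∀ i, ZpExtension (F i) p) (c : ι → ℕ) {b n₀ : ℕ}
    (hle : ∀ n, n₀ ≤ n → classNumberPExp κ n ≤ (∑ i, c i * classNumberPExp (κs i) n) + b)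
    (hμ : ∀ i, ClassicalMuVanishes (κs i)) : ∃ B : ℕ, ∀ m, classGroupPRank κ m ≤ B := by
  obtain ⟨a, b', n₁, h⟩ := exists_classNumberPExp_le_linear_of_le_sum κ κs c hle
    fun i => exists_classNumberPExp_le_linear_of_classicalMuVanishes (κs i) (hμ i)
  exact exists_forall_classGroupPRank_le_of_classNumberPExp_le_linear κ h

end Literature.NumberTheory.IwasawaTheory

end
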